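import Literature.MathematicalPhysics.KineticTheory.HardSphereEulerUniformCoefficients
import Literature.Analysis.FluidPDE.CompressibleEulerAprioriBounds
import HarnessLib

/-!
# σ-uniform coefficient bounds for the hard-sphere equation-of-state family, II:
# the fibred state set and the explicit constants

MathematicalPhysics/KineticTheory proof file (theorems only; no definitions, no named
facts), sequel of `HardSphereEulerUniformCoefficients.lean`. For the rescaled hard-sphere laws
`ζ_τ(s) = Z(sτ)`, `τ = σ³`, with `Z` and the threshold `η_c` of `HsEulerUniform.exists_eos_family`
(`Z, Z + ηZ' ∈ [1/2, 3/2]` on `|η| ≤ η_c`), this file fixes the state set on which the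
symmetrised `H³` energy inequality of `CompressibleEulerAprioriBounds` is run for a classical
solution staying in the box `|ρ - ρ̄|, |ϑ - ϑ̄| ≤ 1/(4M)` around a constant state
`M⁻¹ ≤ ρ̄, ϑ̄ ≤ M` of packing `ρ̄σ³ ≤ η_H = (4/5)η_c`, and computes ALL constants entering that
inequality explicitly in terms of `M` and of the uniform family bound `B` of
`HsEulerUniform.exists_uniform_family_bounds` — hence uniformly in `σ`:

* the fibred state set `K_τ(M, η_c) = [3/(4M), 5M/4]² ∩ {(ρ, ϑ) : ρτ ≤ η_c}` (written inline
  as `(Icc (3/(4M)) (5M/4) ×ˢ Icc (3/(4M)) (5M/4)) ∩ {z | z.1 * τ ≤ η_c}`; compact, in the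
  quadrant, in the hyperbolicity region `(ρζ_τ)' > 0` of the rescaled law:
  `isCompact_fibreSet`, `fibreSet_subset_quadrant`, `fibreSet_subset_hyperbolic`); the box lies
  in it, forces `τ ≤ Mη_H`, and the packing stays in `[0, η_c]` (`mem_fibreSet_of_box`,
  `tau_le_of_box`, `packing_mem_of_mem_fibreSet`);
* the closed forms `dR_Ccoef`, `dT_Ccoef` of the derivatives of the weight `C = 3ρ/(2ϑ)` (those
  of `A = ϑ · Arad ζ` are `CompressibleEuler.dR_Acoef` / `dT_Acoef`);
* `pointwise_bounds`: on a fibre, the weights `A = ϑ Γ₁(ρτ)/ρ`, `ρ`, `C` lie in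
  `[lo/(2hi), 3hi/(2lo)]` (`lo = 3/(4M)`, `hi = 5M/4`) and the eleven state quantities
  `|ρ|, |ϑ|, |A|, |∂_ρA|, |∂_ϑA|, |C|, |∂_ρC|, |∂_ϑC|, |ζ_τ|, |ζ_τ'|, |D|` of the hypothesis `hKb`
  of `CompressibleEuler.abs_integral_timeDerivWithin_weighted_le` are bounded by explicit
  expressions in `(lo, hi, B)`;
* **`exists_uniform_coefficient_bounds`**: the package
  `∀ (EOS hypothesis), ∃ Z η_c η_H, ∀ M ≥ 1, ∃ c₀ c₁ Λ B, ∀ τ ∈ [0, Mη_H], …` with the weight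
  sandwich (shape of `hwK` in `exists_weights_bounds` / `levelEnergy_step_of_weights`), the
  eleven bounds with one `Λ ≥ max(1, 5M/4)`, and `|(Arad ζ_τ)⁽ʲ⁾|, |ζ_τ⁽ʲ⁾| ≤ B`, `j ≤ 4`,
  `B ≥ 1` (input of `CompressibleEuler.coeff_bound_of_mem`) on `K_τ(M, η_c)`.

The only `σ`-dependent inputs are `B` (compactness in `(τ, r) ∈ [0, Mη_H] × [lo, hi]`, no
positivity needed since `Z` is globally smooth) and the weight floor `Γ₁ ≥ 1/2`, which uses the
fibre constraint `ρτ ≤ η_c` guaranteed by `ρ̄σ³ ≤ η_H`.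

## References

* A. Majda, *Compressible Fluid Flow and Systems of Conservation Laws in Several Space
  Variables*, Appl. Math. Sci. 53, Springer 1984: Ch. 2 §2.1, (2.9)–(2.10), Thm 2.2.
  [`Majda1984`]
* C. M. Dafermos, *Hyperbolic Conservation Laws in Continuum Physics*, 2nd ed., Springer 2005:
  Ch. V §5.1, Thm 5.1.1. [`Dafermos2005`]
-/

noncomputable section

open Set Function Filter
open _root_.Topology
open scoped ContDiff

namespace Literature.MathematicalPhysics.KineticTheory

open Literature.Analysis.FunctionSpaces.Torus.DiffMonomial (dR dT)
open Literature.Analysis.FluidPDE.CompressibleEuler (Acoef Ccoef Dcoef Arad quadrant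
  dR_Acoef dT_Acoef)

namespace HsEulerUniform

variable {Z : ℝ → ℝ}

/-! ## §4 The fibred state set and pointwise bounds for the coefficients -/

/-- The **fibred state set** `K_τ(M, η_c) = [3/(4M), 5M/4]² ∩ {(ρ, ϑ) : ρτ ≤ η_c}` — the
density–temperature values of a solution in the box `|ρ - ρ̄|, |ϑ - ϑ̄| ≤ 1/(4M)` around a
constant state `M⁻¹ ≤ ρ̄, ϑ̄ ≤ M` of packing `ρ̄σ³ ≤ (4/5)η_c`, `τ = σ³` (`mem_fibreSet_of_box`);
written inline throughout — is compact. [folklore] -/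
theorem isCompact_fibreSet (M ηc τ : ℝ) :
    IsCompact ((Icc (3 / (4 * M)) (5 * M / 4) ×ˢ Icc (3 / (4 * M)) (5 * M / 4)) ∩
      {z | z.1 * τ ≤ ηc}) :=
  (isCompact_Icc.prod isCompact_Icc).inter_right
    (isClosed_le (continuous_fst.mul continuous_const) continuous_const)

/-- The fibred state set lies in the open quadrant (`M > 0`). [folklore] -/
theorem fibreSet_subset_quadrant {M : ℝ} (hM : 0 < M) (ηc τ : ℝ) :
    (Icc (3 / (4 * M)) (5 * M / 4) ×ˢ Icc (3 / (4 * M)) (5 * M / 4)) ∩ {z | z.1 * τ ≤ ηc} ⊆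
      quadrant := fun z hz =>
  ⟨(show (0 : ℝ) < 3 / (4 * M) by positivity).trans_le hz.1.1.1,
    (show (0 : ℝ) < 3 / (4 * M) by positivity).trans_le hz.1.2.1⟩

/-- The fibred state set lies in the hyperbolicity region `{ρ > 0, ϑ > 0, (ρ ζ_τ)' > 0}` of
the rescaled law `ζ_τ(s) = Z(sτ)`, `τ ≥ 0`, as soon as `Z + ηZ' ≥ 1/2` on `|η| ≤ η_c` (the
hypothesis `hKhyp` of `exists_weights_bounds` / `levelEnergy_step_of_weights`). [folklore] -/
theorem fibreSet_subset_hyperbolic (hZ : ContDiff ℝ ∞ Z) {ηc : ℝ}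
    (hΓ₁ : ∀ η : ℝ, |η| ≤ ηc → 1 / 2 ≤ Z η + η * deriv Z η ∧ Z η + η * deriv Z η ≤ 3 / 2)
    {M : ℝ} (hM : 0 < M) {τ : ℝ} (hτ : 0 ≤ τ) :
    (Icc (3 / (4 * M)) (5 * M / 4) ×ˢ Icc (3 / (4 * M)) (5 * M / 4)) ∩ {z | z.1 * τ ≤ ηc} ⊆
      {z : ℝ × ℝ | 0 < z.1 ∧ 0 < z.2 ∧ 0 < deriv (fun s => s * Z (s * τ)) z.1} := by
  intro z hz
  have hlo : (0 : ℝ) < 3 / (4 * M) := by positivity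
  have hr : 0 < z.1 := hlo.trans_le hz.1.1.1
  refine ⟨hr, hlo.trans_le hz.1.2.1, ?_⟩
  rw [deriv_mul_rescale hZ]
  have hη : |z.1 * τ| ≤ ηc := by
    rw [abs_of_nonneg (mul_nonneg hr.le hτ)]
    exact hz.2
  linarith [(hΓ₁ _ hη).1]

/-- **The box lies in the fibred state set.** If `M ≥ 1`, `M⁻¹ ≤ ρ̄, ϑ̄ ≤ M`,
`|ρ - ρ̄|, |ϑ - ϑ̄| ≤ 1/(4M)`, `τ ≥ 0` and `ρ̄ τ ≤ η_H ≤ (4/5) η_c`, then `(ρ, ϑ) ∈ K_τ(M, η_c)`: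
`ρ ≥ ρ̄ - ρ̄/4 ≥ 3/(4M)`, `ρ ≤ M + M/4`, and `ρτ ≤ (5/4) ρ̄ τ ≤ η_c`. [folklore] -/
theorem mem_fibreSet_of_box {M ρb θb ρ θ τ ηc ηH : ℝ} (hM : 1 ≤ M) (hρb : M⁻¹ ≤ ρb)
    (hρb' : ρb ≤ M) (hθb : M⁻¹ ≤ θb) (hθb' : θb ≤ M) (hρ : |ρ - ρb| ≤ 1 / (4 * M))
    (hθ : |θ - θb| ≤ 1 / (4 * M)) (hτ : 0 ≤ τ) (hpack : ρb * τ ≤ ηH) (hH : ηH ≤ 4 / 5 * ηc) :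
    (ρ, θ) ∈ (Icc (3 / (4 * M)) (5 * M / 4) ×ˢ Icc (3 / (4 * M)) (5 * M / 4)) ∩
      {z | z.1 * τ ≤ ηc} := by
  have hM0 : 0 < M := one_pos.trans_le hM
  have hq : M⁻¹ = 4 * (1 / (4 * M)) := by
    field_simp
  have hlo : 3 / (4 * M) = 3 * (1 / (4 * M)) := by ring
  have hqM : 1 / (4 * M) ≤ M / 4 := by
    rw [div_le_div_iff₀ (by positivity) (by norm_num)]
    nlinarith
  rw [hq] at hρb hθb
  obtain ⟨hρ1, hρ2⟩ := abs_le.1 hρ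
  obtain ⟨hθ1, hθ2⟩ := abs_le.1 hθ
  refine ⟨⟨⟨?_, ?_⟩, ⟨?_, ?_⟩⟩, ?_⟩
  · rw [hlo]; linarith
  · linarith
  · rw [hlo]; linarith
  · linarith
  · show ρ * τ ≤ ηc
    calc ρ * τ ≤ 5 / 4 * ρb * τ := mul_le_mul_of_nonneg_right (by linarith) hτ
      _ = 5 / 4 * (ρb * τ) := by ring
      _ ≤ 5 / 4 * (4 / 5 * ηc) := mul_le_mul_of_nonneg_left (hpack.trans hH) (by norm_num)
      _ = ηc := by ring

/-- On the fibred state set the packing `ρτ` lies in `[0, η₁]` for every `η₁ ≥ η_c` (with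
`η₁ = η₀/2` this is the hypothesis of the bridge
`isHardSphereEulerSolution_iff_isClassicalEulerSolution`). [folklore] -/
theorem packing_mem_of_mem_fibreSet {M ηc η₁ τ : ℝ} (hM : 0 < M) (hτ : 0 ≤ τ) (hη : ηc ≤ η₁)
    {z : ℝ × ℝ}
    (hz : z ∈ (Icc (3 / (4 * M)) (5 * M / 4) ×ˢ Icc (3 / (4 * M)) (5 * M / 4)) ∩
      {z | z.1 * τ ≤ ηc}) :
    z.1 * τ ∈ Icc 0 η₁ :=
  ⟨mul_nonneg ((show (0 : ℝ) < 3 / (4 * M) by positivity).trans_le hz.1.1.1).le hτ,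
    (show z.1 * τ ≤ ηc from hz.2).trans hη⟩

/-- The reduced volume `τ = σ³` of a configuration in the box is at most `M η_H`:
`τ = M (M⁻¹ τ) ≤ M ρ̄ τ ≤ M η_H`. [folklore] -/
theorem tau_le_of_box {M ρb τ ηH : ℝ} (hM : 0 < M) (hρb : M⁻¹ ≤ ρb) (hτ : 0 ≤ τ)
    (hpack : ρb * τ ≤ ηH) : τ ≤ M * ηH :=
  calc τ = M * (M⁻¹ * τ) := by field_simp
    _ ≤ M * (ρb * τ) := by gcongr
    _ ≤ M * ηH := by gcongr

/-- `∂_r C = 3/(2ϑ)` for the weight `C = 3ρ/(2ϑ)` (all real `r, ϑ`). [folklore] -/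
theorem dR_Ccoef (r θ : ℝ) : dR Ccoef r θ = 3 / 2 / θ := by
  show deriv (fun r' => 3 / 2 * r' / θ) r = _
  have h : (fun r' => 3 / 2 * r' / θ) = fun r' => r' * (3 / 2 / θ) := by
    funext r'; ring
  rw [h, deriv_mul_const_field]
  simp

/-- `∂_ϑ C = -(3ρ/2)/ϑ²` for the weight `C = 3ρ/(2ϑ)` (all real `r, ϑ`). [folklore] -/
theorem dT_Ccoef (r θ : ℝ) : dT Ccoef r θ = -(3 / 2 * r) / θ ^ 2 := by
  show deriv (fun θ' => 3 / 2 * r / θ') θ = _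
  have h : (fun θ' => 3 / 2 * r / θ') = fun θ' => 3 / 2 * r * θ'⁻¹ := by
    funext θ'; ring
  rw [h, deriv_const_mul_field, deriv_inv]
  ring

/-- Elementary sandwich: `x Γ / y ∈ [lo a/hi, hi b/lo]` for `x, y ∈ [lo, hi]`, `Γ ∈ [a, b]`,
`lo, a > 0`. [folklore] -/
theorem div_sandwich {lo hi a b x y Γ : ℝ} (hlo : 0 < lo) (ha : 0 < a) (hx : x ∈ Icc lo hi)
    (hy : y ∈ Icc lo hi) (hΓ : Γ ∈ Icc a b) :
    lo * a / hi ≤ x * Γ / y ∧ x * Γ / y ≤ hi * b / lo := by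
  have hhi : 0 < hi := hlo.trans_le (hx.1.trans hx.2)
  have hy0 : 0 < y := hlo.trans_le hy.1
  have hx0 : 0 ≤ x := (hlo.trans_le hx.1).le
  constructor
  · rw [div_le_div_iff₀ hhi hy0]
    exact mul_le_mul (mul_le_mul hx.1 hΓ.1 ha.le hx0) hy.2 hy0.le
      (mul_nonneg hx0 (ha.le.trans hΓ.1))
  · rw [div_le_div_iff₀ hy0 hlo]
    exact mul_le_mul (mul_le_mul hx.2 hΓ.2 (ha.le.trans hΓ.1) hhi.le) hy.1 hlo.le
      (mul_nonneg hhi.le (ha.le.trans (hΓ.1.trans hΓ.2)))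

/-- **Pointwise bounds on a box fibre.** For the rescaled law `ζ_τ(s) = Z(sτ)`, `τ ≥ 0`, at a
state `(r, ϑ) ∈ [lo, hi]²` (`0 < lo ≤ 3/2`, `hi ≥ 1/2`) with `rτ ≤ η_c`, where `Z + ηZ' ∈
[1/2, 3/2]` on `|η| ≤ η_c` and `B` bounds the `r`-derivatives of orders `≤ 4` of `Arad ζ_τ` and
`ζ_τ` at `r`: the symmetriser weights `A = ϑ (Z + ηZ')(rτ)/r`, `ρ`, `C = 3r/(2ϑ)` lie in
`[lo/(2 hi), 3 hi/(2 lo)]`, and the eleven state quantities of the energy inequality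
`abs_integral_timeDerivWithin_weighted_le` are bounded by explicit expressions in
`(lo, hi, B)` — independent of `τ`. [cite: Majda1984, Ch. 2 §2.1 (2.9)] -/
theorem pointwise_bounds (hZ : ContDiff ℝ ∞ Z) {ηc : ℝ}
    (hΓ₁ : ∀ η : ℝ, |η| ≤ ηc → 1 / 2 ≤ Z η + η * deriv Z η ∧ Z η + η * deriv Z η ≤ 3 / 2)
    {lo hi τ B r θ : ℝ} (hlo : 0 < lo) (hhi : 1 / 2 ≤ hi) (hlo' : lo ≤ 3 / 2) (hτ : 0 ≤ τ)
    (hr : r ∈ Icc lo hi) (hθ : θ ∈ Icc lo hi) (hrτ : r * τ ≤ ηc)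
    (hB : ∀ j ≤ 4, |deriv^[j] (Arad fun s => Z (s * τ)) r| ≤ B ∧
      |deriv^[j] (fun s => Z (s * τ)) r| ≤ B) :
    ((lo * (1 / 2) / hi ≤ Acoef (fun s => Z (s * τ)) r θ ∧
          Acoef (fun s => Z (s * τ)) r θ ≤ hi * (3 / 2) / lo) ∧
        (lo * (1 / 2) / hi ≤ r ∧ r ≤ hi * (3 / 2) / lo) ∧
        (lo * (1 / 2) / hi ≤ Ccoef r θ ∧ Ccoef r θ ≤ hi * (3 / 2) / lo)) ∧
      (|r| ≤ hi ∧ |θ| ≤ hi ∧ |Acoef (fun s => Z (s * τ)) r θ| ≤ hi * (3 / 2) / lo ∧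
        |dR (Acoef fun s => Z (s * τ)) r θ| ≤ hi * B ∧
        |dT (Acoef fun s => Z (s * τ)) r θ| ≤ B ∧
        |Ccoef r θ| ≤ hi * (3 / 2) / lo ∧ |dR Ccoef r θ| ≤ 3 / 2 / lo ∧
        |dT Ccoef r θ| ≤ 3 / 2 * hi / lo ^ 2 ∧
        |Z (r * τ)| ≤ B ∧ |deriv (fun s => Z (s * τ)) r| ≤ B ∧
        |Dcoef (fun s => Z (s * τ)) r θ| ≤ hi * B) := by
  have hr0 : 0 < r := hlo.trans_le hr.1
  have hθ0 : 0 < θ := hlo.trans_le hθ.1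
  have hhi0 : 0 < hi := hlo.trans_le (hr.1.trans hr.2)
  have hη : |r * τ| ≤ ηc := by
    rw [abs_of_nonneg (mul_nonneg hr0.le hτ)]
    exact hrτ
  have hΓ := hΓ₁ _ hη
  have hA : Acoef (fun s => Z (s * τ)) r θ = θ * (Z (r * τ) + r * τ * deriv Z (r * τ)) / r := by
    show θ * (Z (r * τ) + r * deriv (fun s => Z (s * τ)) r) / r = _
    rw [rescale_add_mul_deriv hZ]
  have hC : Ccoef r θ = r * (3 / 2) / θ := by
    show 3 / 2 * r / θ = _
    ring
  have hAs : lo * (1 / 2) / hi ≤ Acoef (fun s => Z (s * τ)) r θ ∧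
      Acoef (fun s => Z (s * τ)) r θ ≤ hi * (3 / 2) / lo := by
    rw [hA]
    exact div_sandwich hlo one_half_pos hθ hr ⟨hΓ.1, hΓ.2⟩
  have hCs : lo * (1 / 2) / hi ≤ Ccoef r θ ∧ Ccoef r θ ≤ hi * (3 / 2) / lo := by
    rw [hC]
    exact div_sandwich hlo one_half_pos hr hθ ⟨by norm_num, le_rfl⟩
  have hc0 : 0 < lo * (1 / 2) / hi := by positivity
  have hθhi : |θ| ≤ hi := by rw [abs_of_pos hθ0]; exact hθ.2
  -- the `B`-bounds at orders `0` and `1`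
  have hA0 : |Arad (fun s => Z (s * τ)) r| ≤ B := (hB 0 (Nat.zero_le _)).1
  have hA1 : |deriv (Arad fun s => Z (s * τ)) r| ≤ B := (hB 1 (by norm_num)).1
  have hZ0 : |Z (r * τ)| ≤ B := (hB 0 (Nat.zero_le _)).2
  have hZ1 : |deriv (fun s => Z (s * τ)) r| ≤ B := (hB 1 (by norm_num)).2
  refine ⟨⟨hAs, ⟨?_, ?_⟩, hCs⟩, ?_, hθhi, ?_, ?_, ?_, ?_, ?_, ?_, hZ0, hZ1, ?_⟩
  · calc lo * (1 / 2) / hi ≤ lo := by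
          rw [div_le_iff₀ hhi0]
          exact mul_le_mul_of_nonneg_left hhi hlo.le
      _ ≤ r := hr.1
  · calc r ≤ hi := hr.2
      _ ≤ hi * (3 / 2) / lo := by
          rw [le_div_iff₀ hlo]
          exact mul_le_mul_of_nonneg_left hlo' hhi0.le
  · rw [abs_of_pos hr0]; exact hr.2
  · rw [abs_of_pos (hc0.trans_le hAs.1)]; exact hAs.2
  · simp only [dR_Acoef]
    rw [abs_mul]
    exact mul_le_mul hθhi hA1 (abs_nonneg _) hhi0.le
  · simp only [dT_Acoef]
    exact hA0
  · rw [abs_of_pos (hc0.trans_le hCs.1)]; exact hCs.2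
  · rw [dR_Ccoef, abs_of_pos (by positivity)]
    exact div_le_div_of_nonneg_left (by norm_num) hlo hθ.1
  · rw [dT_Ccoef, abs_div, abs_neg, abs_of_pos (by positivity), abs_of_pos (by positivity)]
    exact div_le_div₀ (by positivity) (by nlinarith [hr.2]) (by positivity)
      (pow_le_pow_left₀ hlo.le hθ.1 2)
  · show |2 / 3 * (θ * Z (r * τ))| ≤ hi * B
    rw [abs_mul, abs_mul, abs_of_pos (by norm_num : (0 : ℝ) < 2 / 3)]
    calc 2 / 3 * (|θ| * |Z (r * τ)|) ≤ 1 * (|θ| * |Z (r * τ)|) :=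
          mul_le_mul_of_nonneg_right (by norm_num) (by positivity)
      _ = |θ| * |Z (r * τ)| := one_mul _
      _ ≤ hi * B := mul_le_mul hθhi hZ0 (abs_nonneg _) hhi0.le

/-! ## §5 The σ-uniform package -/

/-- **σ-uniform coefficient bounds for the hard-sphere equation-of-state family.** Under the
standing equation-of-state hypothesis of `hsEuler_localExistence` there are a smooth `Z` with
`hsCompressibility = Z` on `[0, η₀/2]`, a threshold `η_c ∈ (0, η₀/2]` with
`Z, Z + ηZ' ∈ [1/2, 3/2]` on `|η| ≤ η_c`, and `η_H = (4/5) η_c`, such that for every `M ≥ 1`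
there are constants `0 < c₀ ≤ c₁`, `Λ ≥ max(1, 5M/4)`, `B ≥ 1` — chosen BEFORE the reduced
volume `τ = σ³` — with, for every `τ ∈ [0, M η_H]` and the rescaled law `ζ_τ(s) = Z(sτ)` on
the fibred state set `K_τ(M, η_c) = [3/(4M), 5M/4]² ∩ {ρτ ≤ η_c}`:
(i) the two-sided weight bounds `c₀ ≤ A, ρ, C ≤ c₁` in the shape of the hypothesis `hwK` of
`exists_weights_bounds` / `levelEnergy_step_of_weights`;
(ii) the eleven state bounds of the hypothesis `hKb` of
`abs_integral_timeDerivWithin_weighted_le` with the constant `Λ`;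
(iii) `|∂ʲ(Arad ζ_τ)|, |∂ʲ ζ_τ| ≤ B` for `j ≤ 4` (input of `coeff_bound_of_mem`).
The constants depend on `σ` only through `B`, which is uniform by compactness in
`(τ, r) ∈ [0, Mη_H] × [3/(4M), 5M/4]` (`exists_uniform_family_bounds`); the weight floor
`Z + ηZ' ≥ 1/2` uses the fibre constraint `ρ τ ≤ η_c`. [cite: Majda1984, Ch. 2 §2.1 (2.9)] -/
theorem exists_uniform_coefficient_bounds {η₀ : ℝ} (hη₀ : 0 < η₀) {F : ℝ → ℝ}
    (hF : AnalyticOnNhd ℝ F (Ioo (-η₀) η₀)) (hEq : EqOn hsExcessFreeEnergy F (Ico 0 η₀)) :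
    ∃ Z : ℝ → ℝ, ∃ ηc ηH : ℝ, ContDiff ℝ ∞ Z ∧ EqOn hsCompressibility Z (Icc 0 (η₀ / 2)) ∧
      0 < ηc ∧ ηc ≤ η₀ / 2 ∧ 0 < ηH ∧ ηH = 4 / 5 * ηc ∧
      (∀ η : ℝ, |η| ≤ ηc → (1 / 2 ≤ Z η ∧ Z η ≤ 3 / 2) ∧
        (1 / 2 ≤ Z η + η * deriv Z η ∧ Z η + η * deriv Z η ≤ 3 / 2)) ∧
      ∀ M : ℝ, 1 ≤ M → ∃ c₀ c₁ Λ B : ℝ, 0 < c₀ ∧ c₀ ≤ c₁ ∧ 1 ≤ Λ ∧ 5 * M / 4 ≤ Λ ∧ 1 ≤ B ∧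
        ∀ τ ∈ Icc 0 (M * ηH),
          (∀ z ∈ (Icc (3 / (4 * M)) (5 * M / 4) ×ˢ Icc (3 / (4 * M)) (5 * M / 4)) ∩
            {z : ℝ × ℝ | z.1 * τ ≤ ηc},
            (c₀ ≤ Acoef (fun s => Z (s * τ)) z.1 z.2 ∧ Acoef (fun s => Z (s * τ)) z.1 z.2 ≤ c₁) ∧
              (c₀ ≤ z.1 ∧ z.1 ≤ c₁) ∧ (c₀ ≤ Ccoef z.1 z.2 ∧ Ccoef z.1 z.2 ≤ c₁)) ∧
          (∀ z ∈ (Icc (3 / (4 * M)) (5 * M / 4) ×ˢ Icc (3 / (4 * M)) (5 * M / 4)) ∩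
            {z : ℝ × ℝ | z.1 * τ ≤ ηc},
            |z.1| ≤ Λ ∧ |z.2| ≤ Λ ∧ |Acoef (fun s => Z (s * τ)) z.1 z.2| ≤ Λ ∧
              |dR (Acoef fun s => Z (s * τ)) z.1 z.2| ≤ Λ ∧
              |dT (Acoef fun s => Z (s * τ)) z.1 z.2| ≤ Λ ∧
              |Ccoef z.1 z.2| ≤ Λ ∧ |dR Ccoef z.1 z.2| ≤ Λ ∧ |dT Ccoef z.1 z.2| ≤ Λ ∧
              |Z (z.1 * τ)| ≤ Λ ∧ |deriv (fun s => Z (s * τ)) z.1| ≤ Λ ∧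
              |Dcoef (fun s => Z (s * τ)) z.1 z.2| ≤ Λ) ∧
          (∀ z ∈ (Icc (3 / (4 * M)) (5 * M / 4) ×ˢ Icc (3 / (4 * M)) (5 * M / 4)) ∩
            {z : ℝ × ℝ | z.1 * τ ≤ ηc}, ∀ j ≤ 4,
            |deriv^[j] (Arad fun s => Z (s * τ)) z.1| ≤ B ∧
              |deriv^[j] (fun s => Z (s * τ)) z.1| ≤ B) := by
  obtain ⟨Z, ηc, hZ, hZeq, hηc, hηc₀, hΓ⟩ := exists_eos_family hη₀ hF hEq
  have hΓ₁ : ∀ η : ℝ, |η| ≤ ηc → 1 / 2 ≤ Z η + η * deriv Z η ∧ Z η + η * deriv Z η ≤ 3 / 2 :=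
    fun η hη => (hΓ η hη).2
  refine ⟨Z, ηc, 4 / 5 * ηc, hZ, hZeq, hηc, hηc₀, by positivity, rfl, hΓ, fun M hM => ?_⟩
  have hM0 : 0 < M := one_pos.trans_le hM
  set lo : ℝ := 3 / (4 * M) with hlo_def
  set hi : ℝ := 5 * M / 4 with hhi_def
  have hlo : 0 < lo := by positivity
  have hhi : 1 / 2 ≤ hi := by rw [hhi_def]; linarith
  have hhi0 : 0 < hi := one_half_pos.trans_le hhi
  have hlo' : lo ≤ 3 / 2 := by
    rw [hlo_def, div_le_iff₀ (by positivity)]; linarith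
  have hlohi : lo ≤ hi := by
    rw [hlo_def, hhi_def, div_le_iff₀ (by positivity)]; nlinarith
  obtain ⟨B, -, hB⟩ := exists_uniform_family_bounds hZ (M * (4 / 5 * ηc)) hi hlo 4
  set B' : ℝ := max B 1 with hB'_def
  have hB'1 : 1 ≤ B' := le_max_right _ _
  have hBB' : B ≤ B' := le_max_left _ _
  set c₀ : ℝ := lo * (1 / 2) / hi with hc₀_def
  set c₁ : ℝ := hi * (3 / 2) / lo with hc₁_def
  set Λ : ℝ := 1 + hi + c₁ + hi * B' + B' + 3 / 2 / lo + 3 / 2 * hi / lo ^ 2 with hΛ_def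
  have hc₀ : 0 < c₀ := by positivity
  have hc₁0 : 0 ≤ c₁ := by positivity
  have hc₀₁ : c₀ ≤ c₁ := by
    rw [hc₀_def, hc₁_def, div_le_div_iff₀ hhi0 hlo]
    nlinarith [mul_le_mul hlohi hlohi hlo.le hhi0.le]
  have h1 : 0 ≤ hi * B' := by positivity
  have h2 : 0 ≤ 3 / 2 / lo := by positivity
  have h3 : 0 ≤ 3 / 2 * hi / lo ^ 2 := by positivity
  refine ⟨c₀, c₁, Λ, B', hc₀, hc₀₁, by linarith, by linarith, hB'1, fun τ hτ => ?_⟩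
  have hB'τ : ∀ z ∈ (Icc (3 / (4 * M)) (5 * M / 4) ×ˢ Icc (3 / (4 * M)) (5 * M / 4)) ∩
            {z : ℝ × ℝ | z.1 * τ ≤ ηc}, ∀ j ≤ 4,
      |deriv^[j] (Arad fun s => Z (s * τ)) z.1| ≤ B' ∧
        |deriv^[j] (fun s => Z (s * τ)) z.1| ≤ B' :=
    fun z hz j hj =>
      ⟨((hB τ hτ z.1 hz.1.1 j hj).1).trans hBB', ((hB τ hτ z.1 hz.1.1 j hj).2).trans hBB'⟩
  refine ⟨fun z hz => ?_, fun z hz => ?_, hB'τ⟩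
  · exact (pointwise_bounds hZ hΓ₁ hlo hhi hlo' hτ.1 hz.1.1 hz.1.2 hz.2 (hB'τ z hz)).1
  · obtain ⟨b1, b2, b3, b4, b5, b6, b7, b8, b9, b10, b11⟩ :=
      (pointwise_bounds hZ hΓ₁ hlo hhi hlo' hτ.1 hz.1.1 hz.1.2 hz.2 (hB'τ z hz)).2
    refine ⟨by linarith, by linarith, by linarith, by linarith, by linarith, by linarith,
      by linarith, by linarith, by linarith, by linarith, by linarith⟩

end HsEulerUniform

end Literature.MathematicalPhysics.KineticTheory

end
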